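import Summits.QuantumFields.YangMills.Theorems.PoincareLipschitzSobolevBadCellCount
import Summits.QuantumFields.YangMills.Theorems.PoincareLipschitzSobolevCellTranslation
import Literature.Analysis.Convexity.AnisotropicPerimeterBox
import HarnessLib

/-!
# Crux `HistoryTailL` (stmt-QuantumFields-19936), road R1 (LINE 25 `CompactnessTransfer`, S2♭″ brick (Γ5-C), part 2) — «BAD BONDS CARRY `o(R)` ENERGY»:
# for the cell averages `a y = R³∫_{cell_y}V` of a unit-sphere-valued Sobolev map `V` on the open unit cube, the lattice energy carried by the bonds of
# `box 0 ⌊sR⌋` with a BAD endpoint (`‖a‖² < 1 − κ`) is `R·o(1)` and the bad cells have total volume `o(1)` — the `∃ R₀` interface of (Γ5-C)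

Cell `ym3-torus` (rung R3 = continuum SU(2) Yang–Mills on T³ — a RUNG, NOT the Clay problem); TWIN-WIDTH helper seat `ym-ust-19936-w7` g13 (LEAD
★w1-19936 g10 S2♭″ architecture; Γ5 pens of record 13:02Z: (Γ5-C) = w7).  Helper `--supports stmt-QuantumFields-19936`; THEOREMS ONLY (0 `def`,
0 `sorry`, default heartbeats).  Imports ✓w7 part 1 `…SobolevBadCellCount` (`card_bad_mul_le`, `lintegral_opNorm_sq_lt_top`), ✓px15 g6 FILE C
`…SobolevCellTranslation` ((a-ii) `enorm_sub_smul_setIntegral_cell_sq_le`, `volume_twoCell_lt_top`), lit ✓`Literature.Analysis.Convexity.volume_setOf_apply_eq_zero_three`.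
WHAT IS PROVED (ns `…Theorems.PoincareLipschitzSobolevBadBondEnergy`): §1 letters `twoCell_subset_union`, `lintegral_twoCell_le`, `cell_subset_absCube_of_mem_box`,
`twoCell_subset_absCube_of_mem_box`, `mem_box_succ`, `add_unitVec_mem_box`, `sum_endpoints_le` (each site is an endpoint of ≤ 6 bonds), `card_endpoints_le`,
`card_badBonds_le` (`#bad bonds ≤ 6·#bad sites`); §2 `enorm_bond_sq_le` (per bad bond, from (a-ii)), ★★★`bad_part_small` — the (Γ5-C) interface
`∃ R₀, ∀ R ≥ R₀, ∀ a, (∀ y, a y = R³•∫_{cell_y}V) → R⁻¹·Σ_{bad bonds of box 0 ⌊sR⌋} ‖a(y+e_μ) − a y‖² ≤ ε ∧ R⁻³·#{bad sites of box 0 (⌊sR⌋+1)} ≤ ε`.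
HONEST SCOPE.  One brick of S2♭″'s (Γ5); S2♭″, S1″-band, `hHalvingBand`, K1, `MeanDeviationL`, `BlockLipschitzL`, `HistoryTailL` are NOT proved here; rung R3,
not Clay; YM gap NOT proved; no summit statement is proved here.  Refs: Hardt–Kinderlehrer–Lin, CMP 105 (1986) 547–570 [HardtKinderlehrerLin1986]; Evans, PDE (2010) §5.8.
-/

set_option autoImplicit false
noncomputable section
open MeasureTheory Set Finset
open scoped BigOperators NNReal ENNReal

namespace Summit.QuantumFields.YangMills.Theorems.PoincareLipschitzSobolevBadBondEnergy
open Literature.Analysis.FunctionSpaces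
open Literature.MathematicalPhysics.QuantumFieldTheory.Balaban1983to89
open B4Eq19LatticeOperators (Zd box unitVec mem_box unitVec_apply_self unitVec_apply_ne)
open Summit.QuantumFields.YangMills.Theorems.PoincareLipschitzSobolevCellAverages
  (isOpen_cell volume_cell hasWeakFDerivOn_mono memSobolevDomain_one_two_of_bound)
open Summit.QuantumFields.YangMills.Theorems.PoincareLipschitzSobolevCellTranslation
  (isOpen_twoCell volume_twoCell_lt_top enorm_sub_smul_setIntegral_cell_sq_le)
open Summit.QuantumFields.YangMills.Theorems.PoincareLipschitzSamplingCells (isOpen_absCube disjoint_cell measurableSet_cell)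
open Summit.QuantumFields.YangMills.Theorems.PoincareLipschitzSobolevBadCellCount (card_bad_mul_le lintegral_opNorm_sq_lt_top)

/-! ## §1 Letters: two-cells, boxes, endpoint counting -/

/-- The integer coordinates of `y + e_μ`, cast to `ℝ`. [folklore] -/
theorem cast_add_unitVec_apply (y : Zd 3) (μ i : Fin 3) :
    (((y + unitVec μ) i : ℤ) : ℝ) = (y i : ℝ) + (if i = μ then 1 else 0) := by
  by_cases h : i = μ
  · subst h; simp [Pi.add_apply, unitVec_apply_self]
  · simp [Pi.add_apply, h]

/-- The open two-cell lies in the union of its two open cells and the separating face. [folklore] -/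
theorem twoCell_subset_union (R : ℕ) (y : Zd 3) (μ : Fin 3) :
    {x : EuclideanSpace ℝ (Fin 3) | ∀ i, (y i : ℝ) / R < x i ∧ x i < ((y i : ℝ) + (if i = μ then 2 else 1)) / R} ⊆
      ({x : EuclideanSpace ℝ (Fin 3) | ∀ i, (y i : ℝ) / R < x i ∧ x i < ((y i : ℝ) + 1) / R} ∪
        {x : EuclideanSpace ℝ (Fin 3) | ∀ i, ((y + unitVec μ) i : ℝ) / R < x i ∧ x i < (((y + unitVec μ) i : ℝ) + 1) / R}) ∪
      {x : EuclideanSpace ℝ (Fin 3) | x μ = ((y μ : ℝ) + 1) / R} := by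
  intro x hx
  simp only [Set.mem_setOf_eq] at hx
  rcases lt_trichotomy (x μ) (((y μ : ℝ) + 1) / R) with hlt | heq | hgt
  · refine Or.inl (Or.inl fun i => ⟨(hx i).1, ?_⟩)
    by_cases h : i = μ
    · subst h; exact hlt
    · have := (hx i).2; simpa [h] using this
  · exact Or.inr heq
  · refine Or.inl (Or.inr fun i => ?_)
    rw [cast_add_unitVec_apply]
    by_cases h : i = μ
    · subst h
      refine ⟨by simpa using hgt, ?_⟩
      have := (hx i).2
      simp only [if_true] at this ⊢
      convert this using 2; ring
    · simpa [h] using hx i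

/-- `∫⁻` over a two-cell is at most the sum over its two cells (the face is null). [folklore] -/
theorem lintegral_twoCell_le (R : ℕ) (y : Zd 3) (μ : Fin 3) (g : EuclideanSpace ℝ (Fin 3) → ℝ≥0∞) :
    ∫⁻ x in {x : EuclideanSpace ℝ (Fin 3) | ∀ i, (y i : ℝ) / R < x i ∧ x i < ((y i : ℝ) + (if i = μ then 2 else 1)) / R}, g x ≤
      (∫⁻ x in {x : EuclideanSpace ℝ (Fin 3) | ∀ i, (y i : ℝ) / R < x i ∧ x i < ((y i : ℝ) + 1) / R}, g x) +
        ∫⁻ x in {x : EuclideanSpace ℝ (Fin 3) | ∀ i, ((y + unitVec μ) i : ℝ) / R < x i ∧ x i < (((y + unitVec μ) i : ℝ) + 1) / R},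
          g x := by
  refine (lintegral_mono_set (twoCell_subset_union R y μ)).trans ?_
  refine (lintegral_union_le _ _ _).trans ?_
  rw [setLIntegral_measure_zero _ _ (Literature.Analysis.Convexity.volume_setOf_apply_eq_zero_three μ _), add_zero]
  exact lintegral_union_le _ _ _

/-- A site of `box 0 (n+1)` with `n + 2 ≤ R` has its open cell inside the open unit cube. [folklore] -/
theorem cell_subset_absCube_of_mem_box {R n : ℕ} (hnR : n + 2 ≤ R) {y : Zd 3} (hy : y ∈ box (0 : Zd 3) ((n : ℤ) + 1)) :
    {x : EuclideanSpace ℝ (Fin 3) | ∀ i, (y i : ℝ) / R < x i ∧ x i < ((y i : ℝ) + 1) / R} ⊆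
      {x : EuclideanSpace ℝ (Fin 3) | ∀ i : Fin 3, |x i| < 1} := by
  intro x hx i
  have hR0 : (0 : ℝ) < R := by exact_mod_cast (show 0 < R by omega)
  have hyi : |y i| ≤ (n : ℤ) + 1 := by simpa using (mem_box.mp hy) i
  have hyr : |(y i : ℝ)| ≤ (n : ℝ) + 1 := by exact_mod_cast hyi
  obtain ⟨h1, h2⟩ := hx i
  have hnR' : (n : ℝ) + 2 ≤ R := by exact_mod_cast hnR
  rw [abs_lt]; rw [abs_le] at hyr
  constructor
  · have : (-1 : ℝ) < (y i : ℝ) / R := by rw [lt_div_iff₀ hR0]; linarith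
    linarith
  · have : ((y i : ℝ) + 1) / R ≤ 1 := by rw [div_le_iff₀ hR0]; linarith
    linarith

/-- A site of `box 0 n` with `n + 2 ≤ R` has each of its open two-cells inside the open unit cube. [folklore] -/
theorem twoCell_subset_absCube_of_mem_box {R n : ℕ} (hnR : n + 2 ≤ R) {y : Zd 3} (hy : y ∈ box (0 : Zd 3) (n : ℤ)) (μ : Fin 3) :
    {x : EuclideanSpace ℝ (Fin 3) | ∀ i, (y i : ℝ) / R < x i ∧ x i < ((y i : ℝ) + (if i = μ then 2 else 1)) / R} ⊆
      {x : EuclideanSpace ℝ (Fin 3) | ∀ i : Fin 3, |x i| < 1} := by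
  intro x hx i
  have hR0 : (0 : ℝ) < R := by exact_mod_cast (show 0 < R by omega)
  have hyi : |y i| ≤ (n : ℤ) := by simpa using (mem_box.mp hy) i
  have hyr : |(y i : ℝ)| ≤ (n : ℝ) := by exact_mod_cast hyi
  obtain ⟨h1, h2⟩ := hx i
  have hnR' : (n : ℝ) + 2 ≤ R := by exact_mod_cast hnR
  have hif : (if i = μ then (2 : ℝ) else 1) ≤ 2 := by split_ifs <;> norm_num
  rw [abs_lt]; rw [abs_le] at hyr
  constructor
  · have : (-1 : ℝ) < (y i : ℝ) / R := by rw [lt_div_iff₀ hR0]; linarith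
    linarith
  · have : ((y i : ℝ) + (if i = μ then 2 else 1)) / R ≤ 1 := by rw [div_le_iff₀ hR0]; linarith
    linarith

/-- `box 0 n ⊆ box 0 (n+1)`. [folklore] -/
theorem mem_box_succ {n : ℕ} {y : Zd 3} (hy : y ∈ box (0 : Zd 3) (n : ℤ)) : y ∈ box (0 : Zd 3) ((n : ℤ) + 1) := by
  rw [mem_box] at hy ⊢; exact fun i => (hy i).trans (by omega)

/-- The forward neighbour of a site of `box 0 n` lies in `box 0 (n+1)`. [folklore] -/
theorem add_unitVec_mem_box {n : ℕ} {y : Zd 3} (hy : y ∈ box (0 : Zd 3) (n : ℤ)) (μ : Fin 3) :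
    y + unitVec μ ∈ box (0 : Zd 3) ((n : ℤ) + 1) := by
  rw [mem_box] at hy ⊢
  intro i
  have h := hy i
  simp only [Pi.zero_apply, sub_zero, Pi.add_apply] at h ⊢
  by_cases hi : i = μ
  · subst hi; rw [unitVec_apply_self]; rw [abs_le] at h ⊢; omega
  · rw [unitVec_apply_ne hi, add_zero]; exact h.trans (by omega)

/-- ENDPOINT COUNTING.  Summing a site weight over both endpoints of a set of bonds costs at most `6×` the sum over the endpoint set. [folklore] -/
theorem sum_endpoints_le (B : Finset (Zd 3 × Fin 3)) (c : Zd 3 → ℝ≥0∞) :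
    ∑ e ∈ B, (c e.1 + c (e.1 + unitVec e.2)) ≤
      6 * ∑ y ∈ B.image Prod.fst ∪ B.image (fun e => e.1 + unitVec e.2), c y := by
  classical
  set N : Finset (Zd 3) := B.image Prod.fst ∪ B.image (fun e => e.1 + unitVec e.2) with hN
  have hprod : ∑ e ∈ N ×ˢ (Finset.univ : Finset (Fin 3)), c e.1 = 3 * ∑ y ∈ N, c y := by
    rw [Finset.sum_product, Finset.mul_sum]
    refine Finset.sum_congr rfl fun y _ => ?_
    simp only [Finset.sum_const, Finset.card_univ, Fintype.card_fin, nsmul_eq_mul, Nat.cast_ofNat]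
  have h1 : ∑ e ∈ B, c e.1 ≤ ∑ e ∈ N ×ˢ (Finset.univ : Finset (Fin 3)), c e.1 := by
    refine Finset.sum_le_sum_of_subset fun e he => ?_
    rw [Finset.mem_product]
    exact ⟨Finset.mem_union_left _ (Finset.mem_image_of_mem _ he), Finset.mem_univ _⟩
  have hinj : Set.InjOn (fun e : Zd 3 × Fin 3 => (e.1 + unitVec e.2, e.2)) ↑B := by
    intro e _ e' _ h
    simp only [Prod.mk.injEq] at h
    obtain ⟨h1, h2⟩ := h
    have : e.1 = e'.1 := by rw [h2] at h1; exact add_right_cancel h1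
    exact Prod.ext this h2
  have h2 : ∑ e ∈ B, c (e.1 + unitVec e.2) ≤ ∑ e ∈ N ×ˢ (Finset.univ : Finset (Fin 3)), c e.1 := by
    have heq : ∑ e ∈ B, c (e.1 + unitVec e.2) = ∑ e ∈ B.image (fun e : Zd 3 × Fin 3 => (e.1 + unitVec e.2, e.2)), c e.1 := by
      rw [Finset.sum_image hinj]
    rw [heq]
    refine Finset.sum_le_sum_of_subset fun e he => ?_
    rw [Finset.mem_image] at he
    obtain ⟨e', he', rfl⟩ := he
    rw [Finset.mem_product]
    exact ⟨Finset.mem_union_right _ (Finset.mem_image.mpr ⟨e', he', rfl⟩), Finset.mem_univ _⟩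
  calc ∑ e ∈ B, (c e.1 + c (e.1 + unitVec e.2)) = ∑ e ∈ B, c e.1 + ∑ e ∈ B, c (e.1 + unitVec e.2) := Finset.sum_add_distrib
    _ ≤ 3 * ∑ y ∈ N, c y + 3 * ∑ y ∈ N, c y := by rw [← hprod]; exact add_le_add h1 h2
    _ = 6 * ∑ y ∈ N, c y := by rw [← add_mul]; norm_num

/-- The endpoint set of `B` has at most `2·#B` sites. [folklore] -/
theorem card_endpoints_le (B : Finset (Zd 3 × Fin 3)) :
    ((B.image Prod.fst ∪ B.image (fun e => e.1 + unitVec e.2)).card : ℝ) ≤ 2 * B.card := by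
  classical
  have h := (Finset.card_union_le (B.image Prod.fst) (B.image (fun e => e.1 + unitVec e.2))).trans
    (add_le_add (Finset.card_image_le) (Finset.card_image_le))
  have : ((B.image Prod.fst ∪ B.image (fun e => e.1 + unitVec e.2)).card : ℝ) ≤ (B.card + B.card : ℕ) := by exact_mod_cast h
  simpa [two_mul] using this

/-- BAD BONDS ARE FEW GIVEN FEW BAD SITES: the bonds of `box 0 n` with a bad endpoint number at most `6 ×` the bad sites of `box 0 (n+1)`. [folklore] -/
theorem card_badBonds_le (n : ℕ) (P : Zd 3 → Prop) [DecidablePred P] :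
    ((((box (0 : Zd 3) (n : ℤ)) ×ˢ (Finset.univ : Finset (Fin 3))).filter fun e => P e.1 ∨ P (e.1 + unitVec e.2)).card : ℝ) ≤
      6 * ((box (0 : Zd 3) ((n : ℤ) + 1)).filter P).card := by
  classical
  set Y := (box (0 : Zd 3) ((n : ℤ) + 1)).filter P with hY
  have hsub : (((box (0 : Zd 3) (n : ℤ)) ×ˢ (Finset.univ : Finset (Fin 3))).filter fun e => P e.1 ∨ P (e.1 + unitVec e.2)) ⊆
      (Y ×ˢ (Finset.univ : Finset (Fin 3))) ∪
        (Y ×ˢ (Finset.univ : Finset (Fin 3))).image (fun e : Zd 3 × Fin 3 => (e.1 - unitVec e.2, e.2)) := by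
    intro e he
    rw [Finset.mem_filter, Finset.mem_product] at he
    obtain ⟨⟨hy, -⟩, hP⟩ := he
    rcases hP with h | h
    · exact Finset.mem_union_left _ (Finset.mem_product.mpr ⟨Finset.mem_filter.mpr ⟨mem_box_succ hy, h⟩, Finset.mem_univ _⟩)
    · refine Finset.mem_union_right _ (Finset.mem_image.mpr ⟨(e.1 + unitVec e.2, e.2), ?_, ?_⟩)
      · exact Finset.mem_product.mpr ⟨Finset.mem_filter.mpr ⟨add_unitVec_mem_box hy e.2, h⟩, Finset.mem_univ _⟩
      · simp
  have hcard := (Finset.card_le_card hsub).trans ((Finset.card_union_le _ _).trans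
    (add_le_add le_rfl Finset.card_image_le))
  rw [Finset.card_product, Finset.card_univ, Fintype.card_fin] at hcard
  have : ((((box (0 : Zd 3) (n : ℤ)) ×ˢ (Finset.univ : Finset (Fin 3))).filter fun e => P e.1 ∨ P (e.1 + unitVec e.2)).card : ℝ)
      ≤ ((Y.card * 3 + Y.card * 3 : ℕ) : ℝ) := by exact_mod_cast hcard
  push_cast at this
  linarith

/-- `‖f‖²_{L²(ν)} = ∫⁻ ‖f‖ₑ²` (private copy of px15 D's `eLpNorm_two_pow_two`; private ⇒ no public twin, no wait on D's olean). [folklore] -/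
private theorem eLpNorm_two_sq' {X : Type*} [MeasurableSpace X] {ν : Measure X} {G : Type*} [NormedAddCommGroup G]
    (f : X → G) : eLpNorm f 2 ν ^ 2 = ∫⁻ x, ‖f x‖ₑ ^ 2 ∂ν := by
  rw [eLpNorm_eq_lintegral_rpow_enorm_toReal two_ne_zero ENNReal.ofNat_ne_top, ENNReal.toReal_ofNat]
  simp only [ENNReal.rpow_ofNat, one_div]
  rw [← ENNReal.rpow_natCast ((∫⁻ x, ‖f x‖ₑ ^ 2 ∂ν) ^ (2 : ℝ)⁻¹), ← ENNReal.rpow_mul]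
  norm_num

/-! ## §2 The (Γ5-C) interface: bad bonds carry `o(R)` energy, bad cells have `o(1)` volume -/

/-- PER BAD BOND.  For a bond `(y, μ)` whose two-cell lies in `Q`: `‖a(y+e_μ) − a y‖ₑ² ≤ R·(∫⁻_{cell_y}‖GV‖ₑ² + ∫⁻_{cell_{y+e_μ}}‖GV‖ₑ²)`
((a-ii) ✓`enorm_sub_smul_setIntegral_cell_sq_le` + `‖GV·e_μ‖ ≤ ‖GV‖` + the null face). [cite: Evans2010, §5.8.2 Thm 3 (i)] -/
theorem enorm_bond_sq_le {R : ℕ} (hR : 0 < R) (y : Zd 3) (μ : Fin 3)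
    (V : EuclideanSpace ℝ (Fin 3) → EuclideanSpace ℝ (Fin 4))
    (GV : EuclideanSpace ℝ (Fin 3) → EuclideanSpace ℝ (Fin 3) →L[ℝ] EuclideanSpace ℝ (Fin 4))
    (hGV : HasWeakFDerivOn (⟨{x : EuclideanSpace ℝ (Fin 3) | ∀ i : Fin 3, |x i| < 1}, isOpen_absCube 1⟩ : TopologicalSpace.Opens _)
      volume V GV)
    (hV1 : ∀ x : EuclideanSpace ℝ (Fin 3), (∀ i : Fin 3, |x i| < 1) → ‖V x‖ = 1)
    (hGV2 : ∀ v, MemLp (fun x => GV x v) 2 (volume.restrict {x : EuclideanSpace ℝ (Fin 3) | ∀ i : Fin 3, |x i| < 1}))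
    (hT : {x : EuclideanSpace ℝ (Fin 3) | ∀ i, (y i : ℝ) / R < x i ∧ x i < ((y i : ℝ) + (if i = μ then 2 else 1)) / R} ⊆
      {x : EuclideanSpace ℝ (Fin 3) | ∀ i : Fin 3, |x i| < 1})
    (a : Zd 3 → EuclideanSpace ℝ (Fin 4))
    (ha : ∀ y, a y = ((R : ℝ) ^ 3) • ∫ x in {x : EuclideanSpace ℝ (Fin 3) |
        ∀ i, (y i : ℝ) / R < x i ∧ x i < ((y i : ℝ) + 1) / R}, V x) :
    ‖a (y + unitVec μ) - a y‖ₑ ^ 2 ≤ ENNReal.ofReal (R : ℝ) *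
      ((∫⁻ x in {x : EuclideanSpace ℝ (Fin 3) | ∀ i, (y i : ℝ) / R < x i ∧ x i < ((y i : ℝ) + 1) / R}, ‖GV x‖ₑ ^ 2) +
        ∫⁻ x in {x : EuclideanSpace ℝ (Fin 3) | ∀ i, ((y + unitVec μ) i : ℝ) / R < x i ∧ x i < (((y + unitVec μ) i : ℝ) + 1) / R},
          ‖GV x‖ₑ ^ 2) := by
  have hle : (⟨{x : EuclideanSpace ℝ (Fin 3) | ∀ i, (y i : ℝ) / R < x i ∧ x i < ((y i : ℝ) + (if i = μ then 2 else 1)) / R},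
      isOpen_twoCell R y μ⟩ : TopologicalSpace.Opens _) ≤ ⟨{x : EuclideanSpace ℝ (Fin 3) | ∀ i : Fin 3, |x i| < 1}, isOpen_absCube 1⟩ := hT
  have hVbdd : ∀ᵐ x ∂(volume.restrict {x : EuclideanSpace ℝ (Fin 3) | ∀ i : Fin 3, |x i| < 1}), ‖V x‖ ≤ (1 : ℝ) :=
    (ae_restrict_iff' (isOpen_absCube 1).measurableSet).mpr (Filter.Eventually.of_forall fun x hx => (hV1 x hx).le)
  have hGVT := hasWeakFDerivOn_mono hGV hle
  have hVT := memSobolevDomain_one_two_of_bound hGV hle (volume_twoCell_lt_top R y μ).ne hVbdd hGV2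
  have h := enorm_sub_smul_setIntegral_cell_sq_le hR y μ V GV hVT hGVT
  rw [← ha y, ← ha (y + unitVec μ), eLpNorm_two_sq'] at h
  refine h.trans (mul_le_mul_right ?_ _)
  refine (lintegral_mono fun x => ?_).trans (lintegral_twoCell_le R y μ _)
  have h1 : ‖GV x (EuclideanSpace.single μ (1:ℝ))‖ ≤ ‖GV x‖ := by
    have := (GV x).le_opNorm (EuclideanSpace.single μ (1:ℝ))
    have hn : ‖EuclideanSpace.single μ (1:ℝ)‖ = 1 := by simp
    rwa [hn, mul_one] at this
  have h2 : ‖GV x (EuclideanSpace.single μ (1:ℝ))‖ₑ ≤ ‖GV x‖ₑ := by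
    rw [← ofReal_norm, ← ofReal_norm]; exact ENNReal.ofReal_le_ofReal h1
  exact pow_le_pow_left' h2 2

set_option maxHeartbeats 400000 in -- belt: px14 g6 hb-100k flag (times out at 100k, passes 160k); default 200k passes
/-- ★★★ **THE (Γ5-C) INTERFACE — BAD BONDS CARRY `o(R)` ENERGY, BAD CELLS HAVE `o(1)` VOLUME.**  Let `V` be weakly differentiable on the open unit cube
`Q` with weak gradient `GV`, `‖V‖ = 1` on `Q`, and `GV·v ∈ L²(Q)` for every `v`.  For `0 < κ < 1`, `0 < s < 1`, `ε > 0` there is `R₀` such that for all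
`R ≥ R₀` and the cell-average map `a` (`a y = R³•∫_{cell_y}V`):
`R⁻¹ · Σ_{(y,μ) ∈ box 0 ⌊sR⌋ × Fin 3, ‖a y‖² < 1−κ ∨ ‖a(y+e_μ)‖² < 1−κ} ‖a(y+e_μ) − a y‖² ≤ ε` and `R⁻³ · #{y ∈ box 0 (⌊sR⌋+1) | ‖a y‖² < 1−κ} ≤ ε`.
[cite: HardtKinderlehrerLin1986, §2] -/
theorem bad_part_small
    (V : EuclideanSpace ℝ (Fin 3) → EuclideanSpace ℝ (Fin 4))
    (GV : EuclideanSpace ℝ (Fin 3) → EuclideanSpace ℝ (Fin 3) →L[ℝ] EuclideanSpace ℝ (Fin 4))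
    (hGV : HasWeakFDerivOn (⟨{x : EuclideanSpace ℝ (Fin 3) | ∀ i : Fin 3, |x i| < 1}, isOpen_absCube 1⟩ : TopologicalSpace.Opens _)
      volume V GV)
    (hV1 : ∀ x : EuclideanSpace ℝ (Fin 3), (∀ i : Fin 3, |x i| < 1) → ‖V x‖ = 1)
    (hGV2 : ∀ v, MemLp (fun x => GV x v) 2 (volume.restrict {x : EuclideanSpace ℝ (Fin 3) | ∀ i : Fin 3, |x i| < 1}))
    {κ s ε : ℝ} (hκ : 0 < κ) (hs : 0 < s) (hs1 : s < 1) (hε : 0 < ε) :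
    ∃ R₀ : ℕ, ∀ R : ℕ, R₀ ≤ R → ∀ a : Zd 3 → EuclideanSpace ℝ (Fin 4),
      (∀ y, a y = ((R : ℝ) ^ 3) • ∫ x in {x : EuclideanSpace ℝ (Fin 3) |
        ∀ i, (y i : ℝ) / R < x i ∧ x i < ((y i : ℝ) + 1) / R}, V x) →
      (R : ℝ)⁻¹ * ∑ e ∈ ((box (0 : Zd 3) ⌊s * R⌋) ×ˢ (Finset.univ : Finset (Fin 3))).filter
          (fun e => ‖a e.1‖ ^ 2 < 1 - κ ∨ ‖a (e.1 + unitVec e.2)‖ ^ 2 < 1 - κ),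
          ‖a (e.1 + unitVec e.2) - a e.1‖ ^ 2 ≤ ε ∧
      ((R : ℝ)⁻¹) ^ 3 * (((box (0 : Zd 3) (⌊s * R⌋ + 1)).filter fun y => ‖a y‖ ^ 2 < 1 - κ).card : ℝ) ≤ ε := by
  classical
  set Q : Set (EuclideanSpace ℝ (Fin 3)) := {x | ∀ i : Fin 3, |x i| < 1} with hQdef
  obtain ⟨C, hC⟩ := card_bad_mul_le
  have hItop : ∫⁻ x in Q, ‖GV x‖ₑ ^ 2 < ∞ := lintegral_opNorm_sq_lt_top GV hGV2
  set I : ℝ := (∫⁻ x in Q, ‖GV x‖ₑ ^ 2).toReal with hIdef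
  have hI0 : 0 ≤ I := ENNReal.toReal_nonneg
  have hε6 : ENNReal.ofReal (ε / 6) ≠ 0 := by rw [Ne, ENNReal.ofReal_eq_zero, not_le]; positivity
  obtain ⟨δ, hδ0, hδ⟩ := exists_pos_setLIntegral_lt_of_measure_lt (μ := volume.restrict Q) hItop.ne hε6
  set δ' : ℝ := (min δ 1).toReal with hδ'def
  have hmin_ne : min δ 1 ≠ ∞ := ne_top_of_le_ne_top ENNReal.one_ne_top (min_le_right _ _)
  have hδ'0 : 0 < δ' := ENNReal.toReal_pos (lt_min hδ0 one_pos).ne' hmin_ne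
  have hδ'le : ENNReal.ofReal δ' ≤ δ := by rw [hδ'def, ENNReal.ofReal_toReal hmin_ne]; exact min_le_left _ _
  set M : ℝ := (C : ℝ) ^ 2 * I / κ with hMdef
  have hM0 : 0 ≤ M := by positivity
  obtain ⟨R₀, hR₀⟩ := exists_nat_gt (max (2 / (1 - s)) (max (M / ε) (24 * M / δ')))
  refine ⟨R₀ + 1, fun R hR a ha => ?_⟩
  have hR1 : 1 ≤ R := by omega
  have hRpos : 0 < R := by omega
  have hR0 : (0 : ℝ) < R := by exact_mod_cast hRpos
  have hRR₀ : (R₀ : ℝ) < R := by exact_mod_cast (show R₀ < R by omega)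
  have hRge := (lt_trans hR₀ hRR₀)
  have hR2s : 2 / (1 - s) < R := lt_of_le_of_lt (le_max_left _ _) hRge
  have hRMε : M / ε < R := lt_of_le_of_lt ((le_max_left _ _).trans (le_max_right _ _)) hRge
  have hRMδ : 24 * M / δ' < R := lt_of_le_of_lt ((le_max_right _ _).trans (le_max_right _ _)) hRge
  have hn0 : (0 : ℤ) ≤ ⌊s * R⌋ := Int.floor_nonneg.mpr (by positivity)
  obtain ⟨n, hn⟩ : ∃ n : ℕ, (⌊s * (R : ℝ)⌋ : ℤ) = n := ⟨⌊s * (R : ℝ)⌋.toNat, (Int.toNat_of_nonneg hn0).symm⟩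
  have hnR : n + 2 ≤ R := by
    have h1 : ((n : ℤ) : ℝ) ≤ s * R := by rw [← hn]; exact Int.floor_le _
    have h2 : s * R + 2 ≤ R := by
      have : 2 < (R : ℝ) * (1 - s) := by rwa [div_lt_iff₀ (by linarith)] at hR2s
      nlinarith
    have : ((n : ℕ) : ℝ) + 2 ≤ R := by push_cast at h1 ⊢; linarith
    exact_mod_cast this
  rw [hn]
  set Y : Finset (Zd 3) := (box (0 : Zd 3) ((n : ℤ) + 1)).filter fun y => ‖a y‖ ^ 2 < 1 - κ with hYdef
  have hcellQ : ∀ y ∈ box (0 : Zd 3) ((n : ℤ) + 1),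
      {x : EuclideanSpace ℝ (Fin 3) | ∀ i, (y i : ℝ) / R < x i ∧ x i < ((y i : ℝ) + 1) / R} ⊆ Q :=
    fun y hy => cell_subset_absCube_of_mem_box hnR hy
  have hcount := hC R hRpos V GV hGV hV1 hGV2 (box (0 : Zd 3) ((n : ℤ) + 1)) hcellQ a ha κ hκ
  have hYcard : (Y.card : ℝ) ≤ M * R := by
    have hfin : (C : ℝ≥0∞) ^ 2 * ENNReal.ofReal (R : ℝ) * ∫⁻ x in Q, ‖GV x‖ₑ ^ 2 ≠ ∞ :=
      ENNReal.mul_ne_top (ENNReal.mul_ne_top (ENNReal.pow_ne_top ENNReal.coe_ne_top) ENNReal.ofReal_ne_top) hItop.ne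
    have h := ENNReal.toReal_mono hfin hcount
    rw [ENNReal.toReal_mul, ENNReal.toReal_ofReal hκ.le, ENNReal.toReal_natCast, ENNReal.toReal_mul, ENNReal.toReal_mul,
      ENNReal.toReal_pow, ENNReal.coe_toReal, ENNReal.toReal_ofReal hR0.le] at h
    rw [hMdef, div_mul_eq_mul_div, le_div_iff₀ hκ, mul_comm]
    linarith
  refine ⟨?_, ?_⟩
  swap
  · -- `R⁻³·#Y ≤ M/R² ≤ M/R ≤ ε`
    have h1 : ((R : ℝ)⁻¹) ^ 3 * (Y.card : ℝ) ≤ ((R : ℝ)⁻¹) ^ 3 * (M * R) := mul_le_mul_of_nonneg_left hYcard (by positivity)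
    have h2 : ((R : ℝ)⁻¹) ^ 3 * (M * R) = M / R / R := by field_simp
    have h3 : M / R ≤ ε := by rw [div_le_iff₀ hR0]; rw [div_lt_iff₀ hε] at hRMε; linarith
    have h4 : M / R / R ≤ M / R := div_le_self (by positivity) (by exact_mod_cast hR1)
    linarith
  · -- the bad-bond energy
    set Bb : Finset (Zd 3 × Fin 3) := ((box (0 : Zd 3) (n : ℤ)) ×ˢ (Finset.univ : Finset (Fin 3))).filter
      (fun e => ‖a e.1‖ ^ 2 < 1 - κ ∨ ‖a (e.1 + unitVec e.2)‖ ^ 2 < 1 - κ) with hBbdef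
    set N : Finset (Zd 3) := Bb.image Prod.fst ∪ Bb.image (fun e => e.1 + unitVec e.2) with hNdef
    set c : Zd 3 → ℝ≥0∞ := fun y =>
      ∫⁻ x in {x : EuclideanSpace ℝ (Fin 3) | ∀ i, (y i : ℝ) / R < x i ∧ x i < ((y i : ℝ) + 1) / R}, ‖GV x‖ₑ ^ 2 with hcdef
    have hBb : (Bb.card : ℝ) ≤ 6 * Y.card := by
      have := card_badBonds_le n (fun y => ‖a y‖ ^ 2 < 1 - κ)
      simpa [hBbdef, hYdef] using this
    have hN : (N.card : ℝ) ≤ 12 * M * R := by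
      have := card_endpoints_le Bb
      rw [← hNdef] at this
      nlinarith
    have hNbox : ∀ y ∈ N, y ∈ box (0 : Zd 3) ((n : ℤ) + 1) := by
      intro y hy
      rw [hNdef, Finset.mem_union, Finset.mem_image, Finset.mem_image] at hy
      rcases hy with ⟨e, he, rfl⟩ | ⟨e, he, rfl⟩
      · rw [hBbdef, Finset.mem_filter, Finset.mem_product] at he
        exact mem_box_succ he.1.1
      · rw [hBbdef, Finset.mem_filter, Finset.mem_product] at he
        exact add_unitVec_mem_box he.1.1 e.2
    set U : Set (EuclideanSpace ℝ (Fin 3)) :=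
      ⋃ y ∈ N, {x : EuclideanSpace ℝ (Fin 3) | ∀ i, (y i : ℝ) / R < x i ∧ x i < ((y i : ℝ) + 1) / R} with hUdef
    have hUQ : U ⊆ Q := by
      intro x hx
      rw [hUdef, Set.mem_iUnion₂] at hx
      obtain ⟨y, hy, hxy⟩ := hx
      exact hcellQ y (hNbox y hy) hxy
    have hUmeas : MeasurableSet U := by
      rw [hUdef]; exact Finset.measurableSet_biUnion _ fun y _ => measurableSet_cell R y
    have hUvol : volume U = (N.card : ℝ≥0∞) * ENNReal.ofReal (((R : ℝ)⁻¹) ^ 3) := by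
      rw [hUdef, measure_biUnion_finset (fun y _ y' _ hne => disjoint_cell hRpos hne) (fun y _ => measurableSet_cell R y)]
      simp_rw [volume_cell hRpos]
      rw [Finset.sum_const, nsmul_eq_mul]
    have hUsmall : (volume.restrict Q) U < δ := by
      rw [Measure.restrict_apply hUmeas, Set.inter_eq_left.mpr hUQ, hUvol]
      refine lt_of_lt_of_le ?_ hδ'le
      rw [← ENNReal.ofReal_natCast, ← ENNReal.ofReal_mul (Nat.cast_nonneg _), ENNReal.ofReal_lt_ofReal_iff hδ'0]
      have h1 : (N.card : ℝ) * ((R : ℝ)⁻¹) ^ 3 ≤ 12 * M * R * ((R : ℝ)⁻¹) ^ 3 := mul_le_mul_of_nonneg_right hN (by positivity)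
      have h2 : 12 * M * R * ((R : ℝ)⁻¹) ^ 3 = 12 * M / R / R := by field_simp
      have h3 : 12 * M / R / R ≤ 12 * M / R := div_le_self (by positivity) (by exact_mod_cast hR1)
      have h4 : 12 * M / R < δ' := by
        rw [div_lt_iff₀ hR0]; rw [div_lt_iff₀ hδ'0] at hRMδ; nlinarith
      linarith
    have hUint : ∫⁻ x in U, ‖GV x‖ₑ ^ 2 < ENNReal.ofReal (ε / 6) := by
      have h := hδ U hUsmall
      rwa [Measure.restrict_restrict hUmeas, Set.inter_eq_left.mpr hUQ] at h
    have hsumN : ∑ y ∈ N, c y = ∫⁻ x in U, ‖GV x‖ₑ ^ 2 := by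
      rw [hUdef, lintegral_biUnion_finset (fun y _ y' _ hne => disjoint_cell hRpos hne) (fun y _ => measurableSet_cell R y)]
    have hper : ∀ e ∈ Bb, ‖a (e.1 + unitVec e.2) - a e.1‖ₑ ^ 2 ≤ ENNReal.ofReal (R : ℝ) * (c e.1 + c (e.1 + unitVec e.2)) := by
      intro e he
      rw [hBbdef, Finset.mem_filter, Finset.mem_product] at he
      exact enorm_bond_sq_le hRpos e.1 e.2 V GV hGV hV1 hGV2 (twoCell_subset_absCube_of_mem_box hnR he.1.1 e.2) a ha
    have hsumE : ∑ e ∈ Bb, ‖a (e.1 + unitVec e.2) - a e.1‖ₑ ^ 2 ≤ ENNReal.ofReal (R : ℝ) * (6 * ENNReal.ofReal (ε / 6)) := by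
      calc ∑ e ∈ Bb, ‖a (e.1 + unitVec e.2) - a e.1‖ₑ ^ 2 ≤ ∑ e ∈ Bb, ENNReal.ofReal (R : ℝ) * (c e.1 + c (e.1 + unitVec e.2)) :=
            Finset.sum_le_sum hper
        _ = ENNReal.ofReal (R : ℝ) * ∑ e ∈ Bb, (c e.1 + c (e.1 + unitVec e.2)) := by rw [Finset.mul_sum]
        _ ≤ ENNReal.ofReal (R : ℝ) * (6 * ∑ y ∈ N, c y) := mul_le_mul_right (sum_endpoints_le Bb c) _
        _ ≤ ENNReal.ofReal (R : ℝ) * (6 * ENNReal.ofReal (ε / 6)) := by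
            rw [hsumN]; exact mul_le_mul_right (mul_le_mul_right hUint.le _) _
    have hsumR : ∑ e ∈ Bb, ‖a (e.1 + unitVec e.2) - a e.1‖ ^ 2 ≤ R * ε := by
      have h6 : (6 : ℝ≥0∞) * ENNReal.ofReal (ε / 6) = ENNReal.ofReal ε := by
        rw [← ENNReal.ofReal_ofNat, ← ENNReal.ofReal_mul (by norm_num)]; congr 1; ring
      rw [h6, ← ENNReal.ofReal_mul hR0.le] at hsumE
      have hlhs : ∑ e ∈ Bb, ‖a (e.1 + unitVec e.2) - a e.1‖ₑ ^ 2 = ENNReal.ofReal (∑ e ∈ Bb, ‖a (e.1 + unitVec e.2) - a e.1‖ ^ 2) := by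
        rw [ENNReal.ofReal_sum_of_nonneg (fun e _ => sq_nonneg _)]
        exact Finset.sum_congr rfl fun e _ => by rw [← ofReal_norm, ENNReal.ofReal_pow (norm_nonneg _)]
      rw [hlhs, ENNReal.ofReal_le_ofReal_iff (by positivity)] at hsumE
      exact hsumE
    calc (R : ℝ)⁻¹ * ∑ e ∈ Bb, ‖a (e.1 + unitVec e.2) - a e.1‖ ^ 2 ≤ (R : ℝ)⁻¹ * (R * ε) :=
          mul_le_mul_of_nonneg_left hsumR (by positivity)
      _ = ε := by field_simp

end Summit.QuantumFields.YangMills.Theorems.PoincareLipschitzSobolevBadBondEnergy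

end
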